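import Literature.Analysis.Calculus.RadiiPolynomial
import Mathlib.Analysis.Normed.Operator.BoundedLinearMaps
import HarnessLib

/-!
# The radii-polynomial theorem with two radii, and the non-degeneracy bounds it yields
# (`F'(x)` invertible with `‖F'(x)⁻¹‖ ≤ ‖A‖/(1 − Z)`; `Z₂` from a second-derivative bound)

Topic `Literature/Analysis/Calculus`, companion of `RadiiPolynomial.lean`, whose three forms
(`existsUnique_zero_of_newtonLike`, `existsUnique_zero_of_radiiPolynomial`,
`existsUnique_zero_of_aposterioriValidation`) conclude with ONE ball (existence ball = uniqueness
ball) and with invertibility of `A ∘ F'(x)` only.  Certificate producers report TWO radii — an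
existence radius `r_min` and a uniqueness radius `r_max ≤ r*` — and a bound on `‖F'(x̃)⁻¹‖`
(e.g. the engine `cap.nk` 0.1.1, forms `contraction` / `quadratic`: "exact `[r_min, r_max]`",
"`normA ≥ ‖A‖` adds `‖DF⁻¹‖ ≤ ‖A‖/(1−Z)`"), and every Newton–Kantorovich / radii-polynomial
certificate verifies its Lipschitz datum `Z₂` from an interval bound on the second derivative.
This file PROVES the corresponding statements once, for `F : X → Y` with `X` a real Banach space and
`Y` a real normed space (generic form; the NS enclosure cells and the GRIDFUSION equilibrium /
stability-margin requests cite the same declarations).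

## Printed sources (read on the page)

(1) K. Constantineau, C. García-Azpeitia, J.-P. Lessard, *Spatial relative equilibria and periodic
solutions of the Coulomb `(n+1)`-body problem*, Qual. Theory Dyn. Syst. **20** (2021)
(arXiv:2107.05118) [ConstantineauGarciaAzpeitiaLessard2021], **Theorem 3.1** (arXiv p. 8), verbatim:

> "Consider a finite dimensional Banach space `X` … Let `U ⊂ X` be an open set. Consider a Fréchet
> differentiable mapping `F : U → X` and fix a point `ū ∈ U` (an approximate zero of `F`). Let `A`
> be an approximate inverse of the Jacobian matrix `DF(ū)` … Fix `r_* > 0`. Suppose that the bounds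
> `Y, Z = Z(r_*) > 0` satisfy `‖A F(ū)‖_X ≤ Y` and `sup_{z ∈ B̄_{r_*}(ū)} ‖I − A DF(z)‖_{B(X)} ≤ Z`.
> Define `p(r) = (Z − 1) r + Y`. If there exists `r₀ ∈ (0, r_*]` such that `p(r₀) < 0`, then there
> is a unique `ũ ∈ B_{r₀}(ū)` such that `F(ũ) = 0`."

(`B_r` open, `B̄_r` closed.)  Proof as printed: `T = I − AF` is a `Z`-contraction of `B̄_{r₀}(ū)` by the
mean value inequality with the sup over the LARGER ball `B̄_{r_*}`, maps the closed ball into the OPEN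
ball since `Z r₀ + Y = p(r₀) + r₀ < r₀`, Banach's fixed point theorem; "`Z < 1` … hence `A DF(ū)` is
invertible. From this we get that `A` is invertible."

RENDERING (`existsUnique_zero_of_newtonLike_twoRadii`): `X` real Banach and `Y` real normed instead
of `X = Y` finite-dimensional, with `A : Y →L[ℝ] X` INJECTIVE as a hypothesis (printed: derived from
`dim X < ∞`), `F` differentiable on `B̄_{r_*}(ū)` (printed: on an open `U ⊇ B̄_{r_*}`; only the closed
ball is used).  Conclusions: a zero in the OPEN ball `B_{r₀}` as printed; uniqueness in the larger
CLOSED ball `B̄_{r_*}` (printed: in `B_{r₀}`; the printed contraction estimate holds verbatim on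
`B̄_{r_*}`, so two zeros there coincide — a consequence of the printed proof, stated because it is what a
certificate's "uniqueness radius `r_max`" means); convergence of the Newton-like iterates from `ū`
(Banach).  The non-strict variant `…_of_le` (`Y + Z r₀ ≤ r₀` and `Z < 1`, zero in `B̄_{r₀}`, `r₀ = 0`
allowed) is the form of the B2 enclosure cell's out-of-tree `enclosureB_existsUnique_zero`
(speedrun/enclosure, LevelBEnclosureTheorem.lean v3.8), re-proved here against the tree's `newtonLikeMap`.

(2) J.-P. Lessard, J. D. Mireles James, *Computer assisted Fourier analysis in sequence spaces of
varying regularity*, SIAM J. Math. Anal. **49** (2017) 530–561 [LessardMirelesJames2017],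
**Theorem 1.5** (pp. 4–5; proof Appendix A, pp. 36–37), verbatim:

> "Consider bounded linear operators `A† ∈ B(X, Y)` and `A ∈ B(Y, X)`. Assume `F : X → Y` is a `C¹`
> Fréchet differentiable map, that `A` is injective and that `AF : X → X`. Consider a point `x̄ ∈ X`
> (typically a numerical approximation), and let `Y₀, Z₀, Z₁`, and `Z₂` be nonnegative constants
> satisfying `‖AF(x̄)‖_X ≤ Y₀` (3), `‖I − AA†‖_{B(X)} ≤ Z₀` (4), `‖A[DF(x̄) − A†]‖_{B(X)} ≤ Z₁` (5),
> `‖A[DF(b) − DF(x̄)]‖_{B(X)} ≤ Z₂ r`, for all `b ∈ B̄_r(x̄)` (6). Define the radii polynomial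
> `p(r) = Z₂ r² − (1 − Z₁ − Z₀) r + Y₀` (7). If there exists `r₀ > 0` such that `p(r₀) < 0`, then there
> exists a unique `x̃` in the open ball `B_{r₀}(x̄)` satisfying `F(x̃) = 0`."

(6) is used in the proof (eq. (58)) at `r = r₀`: it is a bound required for every radius `r` at which the
theorem is applied.  RENDERING (`existsUnique_zero_of_radiiPolynomial_twoRadii`): hypothesis (6) for all
`0 < r ≤ r₂` (the form the engine states: "for all `b ∈ B̄(x̄, r)` and all `0 < r ≤ r*`"), `F`
differentiable on `B̄_{r₂}(x̄)`, and TWO radii `0 < r₁ ≤ r₂` with `p(r₁) < 0`, `p(r₂) < 0` (a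
certificate's verified `[r_min, r_max]`): the zero lies in the open ball `B_{r₁}`, is unique in
`B̄_{r₂}`, and `F'(z)` is invertible with `‖F'(z)⁻¹‖ ≤ ‖A‖/(1 − (Z₀ + Z₁ + Z₂ r₂))` for every
`z ∈ B̄_{r₂}(x̄)`.  At `r₁ = r₂` this is Theorem 1.5 as printed plus the non-degeneracy clause.

(3) Non-degeneracy with the NORM of the inverse (`continuousLinearEquiv_of_injective_of_norm_id_sub_comp_le`,
`fderiv_invertible_of_newtonLike`): if `A : Y →L X` is injective and `‖I − A∘B‖ ≤ Z < 1` then `A∘B` is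
invertible with `‖(A∘B)⁻¹‖ ≤ 1/(1 − Z)` (Neumann series, here in the elementary form
`(A∘B)⁻¹ = I + (I − A∘B)(A∘B)⁻¹`), `B` is invertible with inverse `(A∘B)⁻¹ ∘ A` and
`‖B⁻¹‖ ≤ ‖A‖/(1 − Z)`, and `A` is invertible with inverse `B ∘ (A∘B)⁻¹` — completeness of `Y` is not
needed.  Source: the Banach lemma on invertible operators, I. K. Argyros, *Convergence and Applications of
Newton-type Iterations* (Springer 2008) [Argyros2008], §1.1 Thm. 1.1.12 with the bound (1.1.10)
"`‖T⁻¹‖ ≤ ‖P‖/(1 − ‖I − PT‖)`" (there `P, T` operators in `X` with `P` invertible; here `P = A : Y → X`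
injective, `T = B : X → Y`), and R. Kress, *Linear Integral Equations* (2nd ed. 1999) [Kress1999], §2.4
Thm. 2.14 ("`‖(I − A)⁻¹‖ ≤ 1/(1 − ‖A‖)`") for the Neumann bound; the invertibility of `A DF(ū)` and of
`A` is the last step of the printed proof of (1), and the quantitative form is what `cap.nk` prints as
"`‖DF⁻¹‖ ≤ ‖A‖/(1−Z)`".

(4) `Z₂` from a second derivative (`norm_comp_sub_comp_le_of_norm_fderiv₂_le`, `…_of_norm_le_mul`): if
`F'` has a derivative `F''` within `B̄_R(x̄)` and `‖(A∘·) ∘ F''(x)‖ ≤ C₂` there (in particular if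
`‖F''(x)‖ ≤ M₂` and `C₂ = ‖A‖ M₂`), then `‖A∘F'(y) − A∘F'(x)‖ ≤ C₂ ‖y − x‖` on the ball — the mean value
inequality for `x ↦ A ∘ F'(x)`; abstract form of [LessardMirelesJames2017] §3 eq. (27) ("`‖D²F(a)‖ ≤ 2μ‖c‖`
… From this and the Mean Value Theorem follow the Lipschitz bound `‖DF(a) − DF(b)‖ ≤ 2μ‖c‖ ‖a − b‖`").
The Lipschitz form feeds `existsUnique_zero_of_radiiPolynomial_twoRadii_of_lipschitz`.

## What is NOT here
No certificate format and no decidable check (that is `Literature/Computation/Certificates/`); no claim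
about how `Y, Z, Z₂, M₂` are obtained (interval arithmetic — the engine's obligation); no smoothness of
solution branches (`RadiiPolynomialBranch.lean`); the general-degree `Z(r) = Σ Z_k r^k` form is the sup
form at fixed `r` and needs nothing new.

## Mathlib / tree search
`lean search 'radii|Kantorovich|twoRadii|norm_symm_le|equivOfInverse'`: the tree's `RadiiPolynomial*.lean`,
`NewtonKantorovich*.lean`, `SimplifiedNewton.lean` (one radius; `isInvertible_comp_of_newtonLike` without
a norm bound; `SimplifiedNewton.isInvertible_of_norm_sub_le` for an exact inverse); Mathlib:
`ContinuousLinearEquiv.equivOfInverse`, `ContinuousLinearMap.compL`, `Convex.norm_image_sub_le_of_norm_hasFDerivWithin_le`,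
`ContractingWith.exists_fixedPoint'`; no inverse-norm bound for `X →L Y` near an injective-composite.
-/

noncomputable section

open Metric Set Filter Function
open scoped Topology

namespace Literature.Analysis.Calculus

variable {X Y : Type*} [NormedAddCommGroup X] [NormedSpace ℝ X]
  [NormedAddCommGroup Y] [NormedSpace ℝ Y]

/-! ## Non-degeneracy: inverses and their norms from `‖I − A∘B‖ ≤ Z < 1` and injectivity of `A` -/

/-- **Neumann bound** (norm-bound half of [Kress1999] Thm. 2.14: "`‖(I − A)⁻¹‖ ≤ 1/(1 − ‖A‖)`").
For an equivalence `e : X ≃L X` with `‖I − e‖ ≤ Z < 1` one has `‖e⁻¹‖ ≤ 1/(1 − Z)`; since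
invertibility is assumed here (Kress derives it from completeness and the Neumann series), the proof
is the elementary identity `e⁻¹ = I + (I − e) e⁻¹` with `‖I‖ ≤ 1`, and `X` need not be complete.
[cite: Kress1999, §2.4 Thm. 2.14 (norm bound), with A := I − e] -/
theorem norm_symm_le_of_norm_id_sub_le (e : X ≃L[ℝ] X) {Z : ℝ}
    (hZ : ‖ContinuousLinearMap.id ℝ X - (e : X →L[ℝ] X)‖ ≤ Z) (hZ1 : Z < 1) :
    ‖(e.symm : X →L[ℝ] X)‖ ≤ 1 / (1 - Z) := by
  set S : X →L[ℝ] X := (e.symm : X →L[ℝ] X) with hS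
  have key : S = ContinuousLinearMap.id ℝ X + (ContinuousLinearMap.id ℝ X - (e : X →L[ℝ] X)).comp S := by
    ext v
    simp [hS]
  have h1 : ‖S‖ ≤ 1 + Z * ‖S‖ := by
    calc ‖S‖ = ‖ContinuousLinearMap.id ℝ X + (ContinuousLinearMap.id ℝ X - (e : X →L[ℝ] X)).comp S‖ := by
            rw [← key]
      _ ≤ ‖ContinuousLinearMap.id ℝ X‖ + ‖(ContinuousLinearMap.id ℝ X - (e : X →L[ℝ] X)).comp S‖ :=
            norm_add_le _ _
      _ ≤ 1 + ‖ContinuousLinearMap.id ℝ X - (e : X →L[ℝ] X)‖ * ‖S‖ :=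
            add_le_add ContinuousLinearMap.norm_id_le (ContinuousLinearMap.opNorm_comp_le _ _)
      _ ≤ 1 + Z * ‖S‖ := by gcongr
  have h2 : (1 - Z) * ‖S‖ ≤ 1 := by nlinarith [norm_nonneg S]
  rw [le_div_iff₀ (by linarith), mul_comm]
  exact h2

/-- **Inverse of `B` and of `A` from an injective `A` and an invertible `A∘B`.**  If `A : Y →L X` is
injective and `e : X ≃L X` satisfies `e = A ∘ B` for `B : X →L Y`, then `B` is a continuous linear
equivalence `X ≃L Y` with inverse `e⁻¹ ∘ A`, and `A` is a continuous linear equivalence `Y ≃L X` with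
inverse `B ∘ e⁻¹` (no completeness of `Y` needed: `A (B (e⁻¹ A y)) = A y` and injectivity give
`B (e⁻¹ A y) = y`).  This is the algebraic step of the Banach lemma on invertible operators,
[Argyros2008] Thm. 1.1.12 ("`T⁻¹` exists iff there is `P` with `P⁻¹` existing and `‖I − PT‖ < 1`; then
`T⁻¹ = Σ (I − PT)ⁿ P`"), in the variant `P = A : Y → X` between different spaces with `P` only
INJECTIVE (its invertibility becomes a conclusion) and `T = B`.
[cite: Argyros2008, §1.1 Thm. 1.1.12 (Banach lemma on invertible operators), algebraic step; variant with P : Y → X injective] -/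
theorem exists_continuousLinearEquiv_of_injective_comp {A : Y →L[ℝ] X} {B : X →L[ℝ] Y}
    (hA : Injective A) (e : X ≃L[ℝ] X) (he : (e : X →L[ℝ] X) = A.comp B) :
    (∃ L : X ≃L[ℝ] Y, (L : X →L[ℝ] Y) = B ∧ (L.symm : Y →L[ℝ] X) = (e.symm : X →L[ℝ] X).comp A) ∧
      ∃ E : Y ≃L[ℝ] X, (E : Y →L[ℝ] X) = A ∧ (E.symm : X →L[ℝ] Y) = B.comp (e.symm : X →L[ℝ] X) := by
  have hAB : ∀ x : X, A (B x) = e x := fun x => by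
    have := congrArg (fun f : X →L[ℝ] X => f x) he
    simpa using this.symm
  -- left inverse: `e⁻¹ (A (B x)) = x`
  have h₁ : LeftInverse (fun y : Y => e.symm (A y)) (fun x : X => B x) := fun x => by
    simp only [hAB, ContinuousLinearEquiv.symm_apply_apply]
  -- right inverse: `B (e⁻¹ (A y)) = y` by injectivity of `A`
  have h₂ : RightInverse (fun y : Y => e.symm (A y)) (fun x : X => B x) := fun y => by
    apply hA
    simp only [hAB, ContinuousLinearEquiv.apply_symm_apply]
  refine ⟨⟨ContinuousLinearEquiv.equivOfInverse B ((e.symm : X →L[ℝ] X).comp A) h₁ h₂, rfl, rfl⟩,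
    ⟨ContinuousLinearEquiv.equivOfInverse A (B.comp (e.symm : X →L[ℝ] X)) (fun y => h₂ y)
      (fun x => ?_), rfl, rfl⟩⟩
  -- `A (B (e⁻¹ x)) = x`
  simp only [ContinuousLinearMap.coe_comp, ContinuousLinearEquiv.coe_coe, comp_apply, hAB,
    ContinuousLinearEquiv.apply_symm_apply]

/-- **Non-degeneracy with the norm of the inverse.**  `X` real Banach, `Y` real normed, `A : Y →L X`
injective, `B : X →L Y` with `‖I − A∘B‖ ≤ Z < 1`.  Then `B` is invertible (`X ≃L Y`) with
`‖B⁻¹‖ ≤ ‖A‖/(1 − Z)` (indeed `B⁻¹ = (A∘B)⁻¹ ∘ A`), and `A` is invertible (`Y ≃L X`).  This is the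
bound (1.1.10) of the Banach lemma [Argyros2008] Thm. 1.1.12, "`‖T⁻¹‖ ≤ ‖P‖/(1 − ‖I − PT‖)`", with
`P = A`, `T = B`, in the variant where `P : Y → X` maps between different spaces and is only assumed
injective (printed: `P` an invertible operator in `X`); it is also the quantitative form of the last step
of the proof of [ConstantineauGarciaAzpeitiaLessard2021] Thm. 3.1 ("hence `A DF(ū)` is invertible. From
this we get that `A` is invertible"), where in infinite dimension injectivity of `A` must be assumed.
[cite: Argyros2008, §1.1 Thm. 1.1.12 eq. (1.1.10); variant with P : Y → X injective] -/
theorem continuousLinearEquiv_of_injective_of_norm_id_sub_comp_le [CompleteSpace X]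
    {A : Y →L[ℝ] X} {B : X →L[ℝ] Y} {Z : ℝ} (hA : Injective A)
    (hZ : ‖ContinuousLinearMap.id ℝ X - A.comp B‖ ≤ Z) (hZ1 : Z < 1) :
    (∃ L : X ≃L[ℝ] Y, (L : X →L[ℝ] Y) = B ∧ ‖(L.symm : Y →L[ℝ] X)‖ ≤ ‖A‖ / (1 - Z)) ∧
      ∃ E : Y ≃L[ℝ] X, (E : Y →L[ℝ] X) = A := by
  obtain ⟨e, he⟩ := isInvertible_comp_of_norm_id_sub_lt (A := A) (B := B) (lt_of_le_of_lt hZ hZ1)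
  have hnorm : ‖(e.symm : X →L[ℝ] X)‖ ≤ 1 / (1 - Z) :=
    norm_symm_le_of_norm_id_sub_le e (by rw [he]; exact hZ) hZ1
  obtain ⟨⟨L, hL, hLs⟩, ⟨E, hE, -⟩⟩ := exists_continuousLinearEquiv_of_injective_comp hA e he
  refine ⟨⟨L, hL, ?_⟩, ⟨E, hE⟩⟩
  have h1Z : 0 < 1 - Z := by linarith
  calc ‖(L.symm : Y →L[ℝ] X)‖ = ‖(e.symm : X →L[ℝ] X).comp A‖ := by rw [hLs]
    _ ≤ ‖(e.symm : X →L[ℝ] X)‖ * ‖A‖ := ContinuousLinearMap.opNorm_comp_le _ _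
    _ ≤ 1 / (1 - Z) * ‖A‖ := by gcongr
    _ = ‖A‖ / (1 - Z) := by rw [one_div, inv_mul_eq_div]

/-- **Non-degeneracy along the ball, with inverse bound.**  Under the contraction hypothesis of the
radii-polynomial theorem — `A : Y →L X` injective and `‖I − A∘F'(x)‖ ≤ Z < 1` for all `x ∈ B̄_{r}(x̄)` —
every `F'(x)`, `x ∈ B̄_r(x̄)`, is a continuous linear equivalence `X ≃L Y` with `‖F'(x)⁻¹‖ ≤ ‖A‖/(1 − Z)`;
in particular at the zero `x̃` the linearisation is invertible with that bound (the datum a continuation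
step or a stability-margin computation consumes; the engine `cap.nk` prints it as
"`‖DF⁻¹‖ ≤ ‖A‖/(1−Z)`").  Pointwise instance of the previous lemma (Banach lemma bound (1.1.10)).
[cite: Argyros2008, §1.1 Thm. 1.1.12 eq. (1.1.10); applied along the ball of ConstantineauGarciaAzpeitiaLessard2021 Thm. 3.1] -/
theorem fderiv_invertible_of_newtonLike [CompleteSpace X] {F' : X → X →L[ℝ] Y} {xbar : X}
    {A : Y →L[ℝ] X} {Z r : ℝ} (hA : Injective A)
    (hZ : ∀ x ∈ closedBall xbar r, ‖ContinuousLinearMap.id ℝ X - A.comp (F' x)‖ ≤ Z) (hZ1 : Z < 1)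
    {x : X} (hx : x ∈ closedBall xbar r) :
    ∃ L : X ≃L[ℝ] Y, (L : X →L[ℝ] Y) = F' x ∧ ‖(L.symm : Y →L[ℝ] X)‖ ≤ ‖A‖ / (1 - Z) :=
  (continuousLinearEquiv_of_injective_of_norm_id_sub_comp_le hA (hZ x hx) hZ1).1

/-! ## The two-radii theorem -/

section Main

variable [CompleteSpace X]

/-- **Radii-polynomial theorem, two radii, non-strict form.**  `X` real Banach, `Y` real normed,
`A : Y →L X` injective, `0 ≤ r₀ ≤ r_*`, `F` with Fréchet derivative `F'(x)` at every point of
`B̄_{r_*}(x̄)`, `‖A F(x̄)‖ ≤ Y₀`, `‖I − A∘F'(x)‖ ≤ Z` on `B̄_{r_*}(x̄)`, `Z < 1`, and `Y₀ + Z r₀ ≤ r₀`.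
Then `F` has a zero `x⋆ ∈ B̄_{r₀}(x̄)`, it is the only zero of `F` in the LARGER ball `B̄_{r_*}(x̄)`, and
the Newton-like iterates `x_{n+1} = x_n − A F(x_n)` from `x̄` converge to it.  (Proof of
[ConstantineauGarciaAzpeitiaLessard2021] Thm. 3.1: `T = I − AF` is a `Z`-contraction on `B̄_{r_*}` by the
mean value inequality and maps `B̄_{r₀}` into itself; Banach; injectivity of `A`.)  This is the form
`enclosureB_existsUnique_zero` used out-of-tree by the B2 enclosure cell (NS filament, Level B).
[cite: ConstantineauGarciaAzpeitiaLessard2021, Thm. 3.1 (arXiv p. 8), non-strict variant] -/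
theorem existsUnique_zero_of_newtonLike_twoRadii_of_le {F : X → Y} {F' : X → X →L[ℝ] Y} {xbar : X}
    {A : Y →L[ℝ] X} {Y₀ Z r₀ rstar : ℝ} (hr₀ : 0 ≤ r₀) (hr : r₀ ≤ rstar) (hA : Injective A)
    (hF : ∀ x ∈ closedBall xbar rstar, HasFDerivAt F (F' x) x)
    (hY : ‖A (F xbar)‖ ≤ Y₀)
    (hZ : ∀ x ∈ closedBall xbar rstar, ‖ContinuousLinearMap.id ℝ X - A.comp (F' x)‖ ≤ Z)
    (hZ1 : Z < 1) (hp : Y₀ + Z * r₀ ≤ r₀) :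
    ∃ x ∈ closedBall xbar r₀, F x = 0 ∧ (∀ y ∈ closedBall xbar rstar, F y = 0 → y = x) ∧
      Tendsto (fun n => (newtonLikeMap A F)^[n] xbar) atTop (𝓝 x) := by
  set g : X → X := newtonLikeMap A F with hg
  have hrstar : 0 ≤ rstar := hr₀.trans hr
  have hZ₀ : 0 ≤ Z := le_trans (norm_nonneg _) (hZ xbar (mem_closedBall_self hrstar))
  -- `g` is `Z`-Lipschitz on the big ball (mean value inequality)
  have hlip : ∀ x ∈ closedBall xbar rstar, ∀ y ∈ closedBall xbar rstar,
      ‖g y - g x‖ ≤ Z * ‖y - x‖ :=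
    fun x hx y hy => (convex_closedBall xbar rstar).norm_image_sub_le_of_norm_hasFDerivWithin_le
      (fun z hz => (hasFDerivAt_newtonLikeMap (hF z hz)).hasFDerivWithinAt) hZ hx hy
  -- `g` maps the small ball into itself
  have hsub : closedBall xbar r₀ ⊆ closedBall xbar rstar := closedBall_subset_closedBall hr
  have hga : g xbar - xbar = -A (F xbar) := by
    simp [hg, newtonLikeMap_apply]
  have hmaps : MapsTo g (closedBall xbar r₀) (closedBall xbar r₀) := by
    intro x hx
    have hxa : ‖x - xbar‖ ≤ r₀ := mem_closedBall_iff_norm.1 hx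
    rw [mem_closedBall_iff_norm]
    calc ‖g x - xbar‖ = ‖(g x - g xbar) + (g xbar - xbar)‖ := by abel_nf
      _ ≤ ‖g x - g xbar‖ + ‖g xbar - xbar‖ := norm_add_le _ _
      _ ≤ Z * ‖x - xbar‖ + ‖A (F xbar)‖ := by
          gcongr
          · exact hlip xbar (mem_closedBall_self hrstar) x (hsub hx)
          · rw [hga, norm_neg]
      _ ≤ Z * r₀ + Y₀ := by gcongr
      _ ≤ r₀ := by linarith
  -- Banach's fixed point theorem on the complete subset `closedBall xbar r₀`
  obtain ⟨K, hK⟩ : ∃ K : NNReal, (K : ℝ) = Z := ⟨⟨Z, hZ₀⟩, rfl⟩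
  have hK₁ : K < 1 := by
    rw [← NNReal.coe_lt_coe, hK, NNReal.coe_one]
    exact hZ1
  have hlipK : LipschitzOnWith K g (closedBall xbar r₀) := by
    refine LipschitzOnWith.of_dist_le_mul fun x hx y hy => ?_
    rw [dist_eq_norm, dist_eq_norm, hK]
    exact hlip y (hsub hy) x (hsub hx)
  have hc : ContractingWith K (hmaps.restrict g _ _) := ⟨hK₁, hlipK.mapsToRestrict hmaps⟩
  obtain ⟨x, hx, hfix, htend, -⟩ :=
    hc.exists_fixedPoint' isClosed_closedBall.isComplete hmaps (mem_closedBall_self hr₀)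
      (edist_ne_top _ _)
  have hfx : F x = 0 := (newtonLikeMap_eq_self_iff hA F x).1 hfix
  refine ⟨x, hx, hfx, fun y hy hfy => ?_, htend⟩
  -- uniqueness in the big ball: two fixed points of a strict contraction coincide
  have hgy : g y = y := (newtonLikeMap_eq_self_iff hA F y).2 hfy
  have hle : ‖y - x‖ ≤ Z * ‖y - x‖ := by
    have := hlip x (hsub hx) y hy
    rwa [hgy, show g x = x from hfix] at this
  have h0 : ‖y - x‖ = 0 := by
    nlinarith [norm_nonneg (y - x)]
  exact sub_eq_zero.1 (norm_eq_zero.1 h0)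

/-- **Theorem 3.1 of [ConstantineauGarciaAzpeitiaLessard2021] (radii-polynomial theorem with two
radii).**  `X` real Banach, `Y` real normed (printed: `X = Y` finite-dimensional), `A : Y →L X`
injective (printed: derived), `0 < r₀ ≤ r_*`, `F` Fréchet differentiable on `B̄_{r_*}(x̄)` with
derivative `F'`, and bounds `‖A F(x̄)‖ ≤ Y`, `sup_{z ∈ B̄_{r_*}(x̄)} ‖I − A∘F'(z)‖ ≤ Z`.  If
`p(r₀) = (Z − 1) r₀ + Y < 0`, then `F` has a zero `x̃` in the OPEN ball `B_{r₀}(x̄)` (printed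
conclusion), `x̃` is the only zero of `F` in the closed ball `B̄_{r_*}(x̄)` (the printed contraction
estimate on `B̄_{r_*}`; printed statement: unique in `B_{r₀}`), and the Newton-like iterates from `x̄`
converge to `x̃`.  [cite: ConstantineauGarciaAzpeitiaLessard2021, Thm. 3.1 (arXiv p. 8)] -/
theorem existsUnique_zero_of_newtonLike_twoRadii {F : X → Y} {F' : X → X →L[ℝ] Y} {xbar : X}
    {A : Y →L[ℝ] X} {Y₀ Z r₀ rstar : ℝ} (hr₀ : 0 < r₀) (hr : r₀ ≤ rstar) (hA : Injective A)
    (hF : ∀ x ∈ closedBall xbar rstar, HasFDerivAt F (F' x) x)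
    (hY : ‖A (F xbar)‖ ≤ Y₀)
    (hZ : ∀ x ∈ closedBall xbar rstar, ‖ContinuousLinearMap.id ℝ X - A.comp (F' x)‖ ≤ Z)
    (hp : (Z - 1) * r₀ + Y₀ < 0) :
    ∃ x ∈ ball xbar r₀, F x = 0 ∧ (∀ y ∈ closedBall xbar rstar, F y = 0 → y = x) ∧
      Tendsto (fun n => (newtonLikeMap A F)^[n] xbar) atTop (𝓝 x) := by
  have hY₀ : 0 ≤ Y₀ := le_trans (norm_nonneg _) hY
  have hZ1 : Z < 1 := by nlinarith
  obtain ⟨x, hx, hfx, huniq, htend⟩ :=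
    existsUnique_zero_of_newtonLike_twoRadii_of_le hr₀.le hr hA hF hY hZ hZ1 (by linarith)
  refine ⟨x, ?_, hfx, huniq, htend⟩
  -- the zero lies in the open ball: `x = T x` and `‖T x − x̄‖ ≤ Z‖x − x̄‖ + Y₀ ≤ Z r₀ + Y₀ < r₀`
  have hrstar : 0 ≤ rstar := hr₀.le.trans hr
  have hsub : closedBall xbar r₀ ⊆ closedBall xbar rstar := closedBall_subset_closedBall hr
  have hlip : ‖newtonLikeMap A F x - newtonLikeMap A F xbar‖ ≤ Z * ‖x - xbar‖ :=
    (convex_closedBall xbar rstar).norm_image_sub_le_of_norm_hasFDerivWithin_le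
      (fun z hz => (hasFDerivAt_newtonLikeMap (hF z hz)).hasFDerivWithinAt) hZ
      (mem_closedBall_self hrstar) (hsub hx)
  have hfix : newtonLikeMap A F x = x := (newtonLikeMap_eq_self_iff hA F x).2 hfx
  have hga : newtonLikeMap A F xbar - xbar = -A (F xbar) := by
    simp [newtonLikeMap_apply]
  have hxa : ‖x - xbar‖ ≤ r₀ := mem_closedBall_iff_norm.1 hx
  have hZ₀ : 0 ≤ Z := le_trans (norm_nonneg _) (hZ xbar (mem_closedBall_self hrstar))
  rw [mem_ball_iff_norm]
  calc ‖x - xbar‖ = ‖(newtonLikeMap A F x - newtonLikeMap A F xbar) + (newtonLikeMap A F xbar - xbar)‖ := by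
        rw [hfix]; abel_nf
    _ ≤ ‖newtonLikeMap A F x - newtonLikeMap A F xbar‖ + ‖newtonLikeMap A F xbar - xbar‖ :=
        norm_add_le _ _
    _ ≤ Z * ‖x - xbar‖ + Y₀ := by
        gcongr
        rw [hga, norm_neg]
        exact hY
    _ ≤ Z * r₀ + Y₀ := by gcongr
    _ < r₀ := by linarith

/-! ## `Z₂` from a second-derivative bound -/

omit [CompleteSpace X] in
/-- The three bounds `(4)–(6)` of [LessardMirelesJames2017] Thm. 1.5 at radius `r` give
`‖I − A∘F'(x)‖ ≤ Z₀ + Z₁ + Z₂ r` on `B̄_r(x̄)` (triangle inequality; eq. (58) of the printed proof,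
App. A p. 37).  Ball-local version of `norm_id_sub_comp_le_of_bounds`.
[cite: LessardMirelesJames2017, App. A eq. (58) (proof of Thm. 1.5)] -/
theorem norm_id_sub_comp_le_of_bounds_on {F' : X → X →L[ℝ] Y} {xbar : X} {A : Y →L[ℝ] X}
    {Adag : X →L[ℝ] Y} {Z₀ Z₁ Z₂ r : ℝ}
    (hZ₀ : ‖ContinuousLinearMap.id ℝ X - A.comp Adag‖ ≤ Z₀)
    (hZ₁ : ‖A.comp (F' xbar - Adag)‖ ≤ Z₁)
    (hZ₂ : ∀ b ∈ closedBall xbar r, ‖A.comp (F' b - F' xbar)‖ ≤ Z₂ * r)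
    {x : X} (hx : x ∈ closedBall xbar r) :
    ‖ContinuousLinearMap.id ℝ X - A.comp (F' x)‖ ≤ Z₀ + Z₁ + Z₂ * r := by
  have hsplit : ContinuousLinearMap.id ℝ X - A.comp (F' x) =
      (ContinuousLinearMap.id ℝ X - A.comp Adag) + (-(A.comp (F' xbar - Adag)))
        + (-(A.comp (F' x - F' xbar))) := by
    ext v
    simp only [sub_apply, add_apply, neg_apply, ContinuousLinearMap.comp_apply,
      ContinuousLinearMap.id_apply, map_sub]
    abel
  rw [hsplit]
  calc ‖(ContinuousLinearMap.id ℝ X - A.comp Adag) + (-(A.comp (F' xbar - Adag)))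
          + (-(A.comp (F' x - F' xbar)))‖
        ≤ ‖ContinuousLinearMap.id ℝ X - A.comp Adag‖ + ‖-(A.comp (F' xbar - Adag))‖
          + ‖-(A.comp (F' x - F' xbar))‖ := norm_add₃_le
    _ ≤ Z₀ + Z₁ + Z₂ * r := by
        rw [norm_neg, norm_neg]
        gcongr
        exact hZ₂ x hx

omit [CompleteSpace X] in
/-- **`Z₂` from a bound on the second derivative, composite form.**  If `F'` has derivative `F''(x)`
within the ball `B̄_R(x̄)` at each of its points and `‖(A ∘ ·) ∘ F''(x)‖ ≤ C₂` there (the operator norm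
of `v ↦ A ∘ (F''(x) v)`, `X →L (X →L X)`), then `‖A∘F'(y) − A∘F'(x)‖ ≤ C₂ ‖y − x‖` for all `x, y` in the
ball — the mean value inequality applied to `x ↦ A ∘ F'(x)`.  This is the abstract form of the step
"`‖D²F(a)‖ ≤ 2μ‖c‖` … From this and the Mean Value Theorem follow the Lipschitz bound
`‖DF(a) − DF(b)‖ ≤ 2μ‖c‖ ‖a − b‖`" of [LessardMirelesJames2017] §3, eq. (27) (there for the concrete
`F` of the Fisher equation; here for any `F'` with a derivative within the ball, composed with `A`).
(Out-of-tree precedent: `lipschitz_of_composite_second_derivative_bound` of the B2 enclosure cell.)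
[cite: LessardMirelesJames2017, §3 eq. (27) (Lipschitz bound on DF from a bound on D²F by the Mean Value Theorem), abstract form] -/
theorem norm_comp_sub_comp_le_of_norm_fderiv₂_le {F' : X → X →L[ℝ] Y}
    {F'' : X → X →L[ℝ] (X →L[ℝ] Y)} {xbar : X} {A : Y →L[ℝ] X} {R C₂ : ℝ}
    (hF'' : ∀ x ∈ closedBall xbar R, HasFDerivWithinAt F' (F'' x) (closedBall xbar R) x)
    (hC : ∀ x ∈ closedBall xbar R,
      ‖((ContinuousLinearMap.compL ℝ X Y X) A).comp (F'' x)‖ ≤ C₂)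
    {x y : X} (hx : x ∈ closedBall xbar R) (hy : y ∈ closedBall xbar R) :
    ‖A.comp (F' y) - A.comp (F' x)‖ ≤ C₂ * ‖y - x‖ := by
  -- `G = (compL A) ∘ F'` has derivative `(compL A) ∘ F''(x)` within the ball
  have hG : ∀ z ∈ closedBall xbar R, HasFDerivWithinAt (fun z => A.comp (F' z))
      (((ContinuousLinearMap.compL ℝ X Y X) A).comp (F'' z)) (closedBall xbar R) z := by
    intro z hz
    have h := ((ContinuousLinearMap.compL ℝ X Y X) A).hasFDerivAt.comp_hasFDerivWithinAt z (hF'' z hz)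
    refine h.congr (fun w _ => ?_) ?_ <;> simp [ContinuousLinearMap.compL_apply]
  exact (convex_closedBall xbar R).norm_image_sub_le_of_norm_hasFDerivWithin_le hG hC hx hy

omit [CompleteSpace X] in
/-- **`Z₂ = ‖A‖·M₂` from `‖F''‖ ≤ M₂`, product form.**  If `F'` has derivative `F''(x)` within
`B̄_R(x̄)` with `‖F''(x)‖ ≤ M₂` there, then `‖A∘F'(y) − A∘F'(x)‖ ≤ (‖A‖ M₂) ‖y − x‖` on the ball
(`‖(A∘·)∘F''(x)‖ ≤ ‖A‖ ‖F''(x)‖` pointwise, then the composite form); abstract form of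
[LessardMirelesJames2017] §3 eq. (27) with the approximate inverse `A` composed in.
[cite: LessardMirelesJames2017, §3 eq. (27) (‖DF(a) − DF(b)‖ ≤ M‖a − b‖ from ‖D²F‖ ≤ M, Mean Value Theorem), abstract form with A] -/
theorem norm_comp_sub_comp_le_of_norm_le_mul {F' : X → X →L[ℝ] Y}
    {F'' : X → X →L[ℝ] (X →L[ℝ] Y)} {xbar : X} {A : Y →L[ℝ] X} {R M₂ : ℝ}
    (hF'' : ∀ x ∈ closedBall xbar R, HasFDerivWithinAt F' (F'' x) (closedBall xbar R) x)
    (hM : ∀ x ∈ closedBall xbar R, ‖F'' x‖ ≤ M₂)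
    {x y : X} (hx : x ∈ closedBall xbar R) (hy : y ∈ closedBall xbar R) :
    ‖A.comp (F' y) - A.comp (F' x)‖ ≤ ‖A‖ * M₂ * ‖y - x‖ := by
  refine norm_comp_sub_comp_le_of_norm_fderiv₂_le hF'' (fun z hz => ?_) hx hy
  have hM₀ : 0 ≤ M₂ := (norm_nonneg (F'' z)).trans (hM z hz)
  refine ContinuousLinearMap.opNorm_le_bound _ (mul_nonneg (norm_nonneg A) hM₀) fun v => ?_
  calc ‖(((ContinuousLinearMap.compL ℝ X Y X) A).comp (F'' z)) v‖ = ‖A.comp (F'' z v)‖ := by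
        simp [ContinuousLinearMap.compL_apply]
    _ ≤ ‖A‖ * ‖F'' z v‖ := ContinuousLinearMap.opNorm_comp_le _ _
    _ ≤ ‖A‖ * (‖F'' z‖ * ‖v‖) := by
        gcongr
        exact ContinuousLinearMap.le_opNorm _ _
    _ ≤ ‖A‖ * (M₂ * ‖v‖) := by
        gcongr
        exact hM z hz
    _ = ‖A‖ * M₂ * ‖v‖ := by ring

/-! ## The `(Y₀, Z₀, Z₁, Z₂)` form with two radii and the inverse bound -/

/-- **Theorem 1.5 of [LessardMirelesJames2017] (radii polynomial approach), two-radii form with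
non-degeneracy.**  `X` real Banach, `Y` real normed, `A† : X →L Y`, `A : Y →L X` injective, `x̄ ∈ X`,
`0 < r₁ ≤ r₂`, `F` Fréchet differentiable on `B̄_{r₂}(x̄)` with derivative `F'` (printed: `C¹` on `X`;
only the ball is used), nonnegative constants with `‖A F(x̄)‖ ≤ Y₀` (3), `‖I − A A†‖ ≤ Z₀` (4),
`‖A(F'(x̄) − A†)‖ ≤ Z₁` (5), and (6) in the form "`‖A(F'(b) − F'(x̄))‖ ≤ Z₂ r` for all `b ∈ B̄_r(x̄)`
and all `0 < r ≤ r₂`".  If the radii polynomial `p(r) = Z₂ r² − (1 − Z₁ − Z₀) r + Y₀` (7) is negative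
at `r₁` AND at `r₂`, then: `F` has a zero `x̃` in the open ball `B_{r₁}(x̄)`; it is the only zero of `F`
in `B̄_{r₂}(x̄)`; for every `z ∈ B̄_{r₂}(x̄)`, `F'(z)` is a continuous linear equivalence `X ≃L Y` with
`‖F'(z)⁻¹‖ ≤ ‖A‖/(1 − (Z₀ + Z₁ + Z₂ r₂))`; and the Newton-like iterates from `x̄` converge to `x̃`.  At
`r₁ = r₂ = r₀` the first two clauses are Theorem 1.5 as printed.  (Proof: `‖I − A∘F'‖ ≤ Z₀+Z₁+Z₂r`
on `B̄_r`, eq. (58), then `existsUnique_zero_of_newtonLike_twoRadii` at `r₁` and at `r₂`, and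
`fderiv_invertible_of_newtonLike`.)
[cite: LessardMirelesJames2017, Thm. 1.5 (pp. 4–5; proof App. A pp. 36–37), two-radii form] -/
theorem existsUnique_zero_of_radiiPolynomial_twoRadii {F : X → Y} {F' : X → X →L[ℝ] Y}
    {xbar : X} {A : Y →L[ℝ] X} {Adag : X →L[ℝ] Y} {Y₀ Z₀ Z₁ Z₂ r₁ r₂ : ℝ}
    (hr₁ : 0 < r₁) (hr : r₁ ≤ r₂) (hA : Injective A)
    (hF : ∀ x ∈ closedBall xbar r₂, HasFDerivAt F (F' x) x)
    (hY : ‖A (F xbar)‖ ≤ Y₀)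
    (hZ₀ : ‖ContinuousLinearMap.id ℝ X - A.comp Adag‖ ≤ Z₀)
    (hZ₁ : ‖A.comp (F' xbar - Adag)‖ ≤ Z₁)
    (hZ₂ : ∀ r, 0 < r → r ≤ r₂ → ∀ b ∈ closedBall xbar r, ‖A.comp (F' b - F' xbar)‖ ≤ Z₂ * r)
    (hp₁ : Z₂ * r₁ ^ 2 - (1 - Z₁ - Z₀) * r₁ + Y₀ < 0)
    (hp₂ : Z₂ * r₂ ^ 2 - (1 - Z₁ - Z₀) * r₂ + Y₀ < 0) :
    ∃ x ∈ ball xbar r₁, F x = 0 ∧ (∀ y ∈ closedBall xbar r₂, F y = 0 → y = x) ∧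
      (∀ z ∈ closedBall xbar r₂, ∃ L : X ≃L[ℝ] Y, (L : X →L[ℝ] Y) = F' z ∧
        ‖(L.symm : Y →L[ℝ] X)‖ ≤ ‖A‖ / (1 - (Z₀ + Z₁ + Z₂ * r₂))) ∧
      Tendsto (fun n => (newtonLikeMap A F)^[n] xbar) atTop (𝓝 x) := by
  have hr₂ : 0 < r₂ := lt_of_lt_of_le hr₁ hr
  -- contraction bounds on the two balls
  have hZr₂ : ∀ x ∈ closedBall xbar r₂,
      ‖ContinuousLinearMap.id ℝ X - A.comp (F' x)‖ ≤ Z₀ + Z₁ + Z₂ * r₂ :=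
    fun x hx => norm_id_sub_comp_le_of_bounds_on hZ₀ hZ₁ (hZ₂ r₂ hr₂ le_rfl) hx
  have hZr₁ : ∀ x ∈ closedBall xbar r₁,
      ‖ContinuousLinearMap.id ℝ X - A.comp (F' x)‖ ≤ Z₀ + Z₁ + Z₂ * r₁ :=
    fun x hx => norm_id_sub_comp_le_of_bounds_on hZ₀ hZ₁ (hZ₂ r₁ hr₁ hr) hx
  have hF₁ : ∀ x ∈ closedBall xbar r₁, HasFDerivAt F (F' x) x :=
    fun x hx => hF x (closedBall_subset_closedBall hr hx)
  -- existence in the open ball `B_{r₁}` (Thm. 3.1 at `r₀ = r_* = r₁`)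
  obtain ⟨x, hx, hfx, -, htend⟩ := existsUnique_zero_of_newtonLike_twoRadii hr₁ le_rfl hA hF₁ hY hZr₁
    (by nlinarith)
  -- uniqueness in `B̄_{r₂}` (Thm. 3.1 at `r₀ = r_* = r₂`)
  obtain ⟨x', -, hfx', huniq', -⟩ := existsUnique_zero_of_newtonLike_twoRadii hr₂ le_rfl hA hF hY hZr₂
    (by nlinarith)
  have hxx' : x = x' :=
    huniq' x (closedBall_subset_closedBall hr (ball_subset_closedBall hx)) hfx
  have hY₀ : 0 ≤ Y₀ := le_trans (norm_nonneg _) hY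
  have hZ1 : Z₀ + Z₁ + Z₂ * r₂ < 1 := by nlinarith
  refine ⟨x, hx, hfx, fun y hy hfy => ?_, fun z hz => fderiv_invertible_of_newtonLike hA hZr₂ hZ1 hz,
    htend⟩
  rw [hxx']
  exact huniq' y hy hfy

/-- **Theorem 1.5 of [LessardMirelesJames2017], two-radii form, Lipschitz hypothesis.**  As
`existsUnique_zero_of_radiiPolynomial_twoRadii`, with (6) replaced by the Lipschitz bound
`‖A(F'(b) − F'(x̄))‖ ≤ Z₂ ‖b − x̄‖` for `b ∈ B̄_{r₂}(x̄)` and `Z₂ ≥ 0` (the form obtained from a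
second-derivative bound, `norm_comp_sub_comp_le_of_norm_le_mul`), which implies (6) at every radius
`r ≤ r₂`.  [cite: LessardMirelesJames2017, Thm. 1.5 (pp. 4–5), two-radii form with Lipschitz hypothesis (6)] -/
theorem existsUnique_zero_of_radiiPolynomial_twoRadii_of_lipschitz {F : X → Y} {F' : X → X →L[ℝ] Y}
    {xbar : X} {A : Y →L[ℝ] X} {Adag : X →L[ℝ] Y} {Y₀ Z₀ Z₁ Z₂ r₁ r₂ : ℝ}
    (hr₁ : 0 < r₁) (hr : r₁ ≤ r₂) (hA : Injective A)
    (hF : ∀ x ∈ closedBall xbar r₂, HasFDerivAt F (F' x) x)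
    (hY : ‖A (F xbar)‖ ≤ Y₀)
    (hZ₀ : ‖ContinuousLinearMap.id ℝ X - A.comp Adag‖ ≤ Z₀)
    (hZ₁ : ‖A.comp (F' xbar - Adag)‖ ≤ Z₁) (hZ₂0 : 0 ≤ Z₂)
    (hZ₂ : ∀ b ∈ closedBall xbar r₂, ‖A.comp (F' b - F' xbar)‖ ≤ Z₂ * ‖b - xbar‖)
    (hp₁ : Z₂ * r₁ ^ 2 - (1 - Z₁ - Z₀) * r₁ + Y₀ < 0)
    (hp₂ : Z₂ * r₂ ^ 2 - (1 - Z₁ - Z₀) * r₂ + Y₀ < 0) :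
    ∃ x ∈ ball xbar r₁, F x = 0 ∧ (∀ y ∈ closedBall xbar r₂, F y = 0 → y = x) ∧
      (∀ z ∈ closedBall xbar r₂, ∃ L : X ≃L[ℝ] Y, (L : X →L[ℝ] Y) = F' z ∧
        ‖(L.symm : Y →L[ℝ] X)‖ ≤ ‖A‖ / (1 - (Z₀ + Z₁ + Z₂ * r₂))) ∧
      Tendsto (fun n => (newtonLikeMap A F)^[n] xbar) atTop (𝓝 x) :=
  existsUnique_zero_of_radiiPolynomial_twoRadii hr₁ hr hA hF hY hZ₀ hZ₁
    (fun r hr0 hrr b hb => (hZ₂ b (closedBall_subset_closedBall hrr hb)).trans (by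
      have := mem_closedBall_iff_norm.1 hb
      gcongr))
    hp₁ hp₂

end Main

end Literature.Analysis.Calculus

end
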